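import Literature.AlgebraicGeometry.AbelianSchemes.PDivisibleGroupRingAction
import Literature.AlgebraicGeometry.AbelianSchemes.PDivisibleGroupBlockHeightTransport
import HarnessLib

/-!
# Equivariant isomorphisms of abelian schemes preserve the ranks of the `w`-blocks of `𝒜[p^∞]`
# ([Tate1967] §2 (2.1); [GortzWedhorn2020] Def. 4.45 (2): the rank of a finite locally free morphism)

Layer `Literature/AlgebraicGeometry/AbelianSchemes`, namespaces `Literature.AlgebraicGeometry.AbelianSchemes.AbelianSchemeOver` (§1) and
`Literature.AlgebraicGeometry.AbelianSchemes.AbelianSchemeOver.RingAction` (§2–§4).  ONE plumbing `def` (`torsionIsoOfIso`, an `Iso` whose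
components are the ★ `torsionMap`s — data, no `Prop` asserted) + THEOREMS; no named fact, no instance, no notation, no `sorry`.
Cell `hodgecm-mathlib` (D-0151), FLOOR 0, P6 «MOD programme» (crux hLiu418 = stmt-HodgeConjecture-24832), K∕BT desk F0P6d-plan (g2)
DEAL 13 «(ISO) EQUIVARIANT ISOMORPHISMS PRESERVE BLOCK RANKS» (the PACKAGED abelian-scheme form of ★ `finrank_fix_hom_eq_of_iso`, p846578 §1,
for the consumer GEN A-p18 (g30) step (5) `hrank_sch₀Of_of_isSmoothProper`: the `hrank` binder of ★ ED. 7 `blockDocking_of_line` moves along an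
`O`-equivariant isomorphism `𝒜₁ ≅ 𝒜₂`).  HC_CM is proved only modulo the printed citations until rung 0 closes; nothing here is about HC.

* §1 `torsionIsoOfIso (φ : 𝒜₁.X ≅ 𝒜₂.X) [IsMonHom φ.hom] (N) : 𝒜₁[N] ≅ 𝒜₂[N]` (`hom = torsionMap φ.hom N`, `inv = torsionMap φ.inv N`),
  `torsionIsoOfIso_hom`, `torsionIsoOfIso_inv` (`rfl`);
* §2 `torsionMap_comm_of_comm` — if `φ` intertwines `ι₁(r)` and `ι₂(r)` then `φ[N]` intertwines `ι₁(r)[N]` and `ι₂(r)[N]`;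
* §3 **`finrank_fixLayer_eq_of_iso`** — for ring actions `act₁`, `act₂` of `O` on `𝒜₁`, `𝒜₂` over `Spec R`, an `O`-equivariant isomorphism
  `φ` of abelian schemes, `p ≠ 0` and a compatible idempotent family `a` (`aₙ₊₁ ≡ aₙ`, `aₙ² ≡ aₙ (mod pⁿ)`): the fixed parts of
  `ε₁ := β₁(a)`, `ε₂ := β₂(a)` on `𝒜₁[p^∞]`, `𝒜₂[p^∞]` (★ `isRingActionBT_pDivisibleGroupMap`, ★ `homOfCompatibleFamily`, ★ `fixLayer`) have
  the same rank in every layer at every `s` (★ `finrank_fix_hom_eq_of_iso` along `torsionIsoOfIso φ (pⁿ)`, §2 at `r := aₙ`);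
* §4 **`hrank_of_iso`** — hence the `hrank` hypothesis «`rk_s (Fix ε)_n = p^{n h}` for all `n`, `s`» transports from `(𝒜₁, act₁)` to
  `(𝒜₂, act₂)` (ED. 7's binder VERBATIM at `(𝒜₂, act₂)`).

## References
* [Tate1967] J. Tate, *p-divisible groups* (1967), §2 (2.1) (the layers `G_n` and homomorphisms of `p`-divisible groups).
* [GortzWedhorn2020] U. Görtz, T. Wedhorn, *Algebraic Geometry I*, 2nd ed. (2020), Definition 4.45 (2) (p. 117); Section (4.7) (pp. 107–108).
* [Kottwitz1992] R. Kottwitz, *Points on some Shimura varieties over finite fields*, JAMS 5 (1992), §5 (p. 390).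
-/

set_option autoImplicit false

noncomputable section

universe u v

open CategoryTheory CategoryTheory.Limits AlgebraicGeometry MonoidalCategory CartesianMonoidalCategory
open scoped MonObj

namespace Literature.AlgebraicGeometry.AbelianSchemes

namespace AbelianSchemeOver

open Literature.AlgebraicGeometry.GroupSchemes IdempotentSplitting

/-! ## §1 `𝒜₁[N] ≅ 𝒜₂[N]` from an isomorphism of abelian schemes -/

section TorsionIso

variable {S : Scheme.{u}} {A₁ A₂ : AbelianSchemeOver S} (φ : A₁.X ≅ A₂.X) [IsMonHom φ.hom]

/-- **An isomorphism `φ : 𝒜₁ ≅ 𝒜₂` of `S`-group schemes induces `φ[N] : 𝒜₁[N] ≅ 𝒜₂[N]`** with components the ★ `torsionMap`s of `φ` and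
`φ⁻¹` (`φ⁻¹` is a homomorphism, Mathlib).  Plumbing (an `Iso`; the identities are ★ `torsionMap_ι` through ★ `torsion_hom_ext`).
[cite: Tate1967, §2 (2.1)] -/
def torsionIsoOfIso (N : ℕ) : A₁.torsion N ≅ A₂.torsion N where
  hom := torsionMap φ.hom N
  inv := torsionMap φ.inv N
  hom_inv_id := A₁.torsion_hom_ext (by
    rw [Category.assoc, torsionMap_ι, torsionMap_ι_assoc, φ.hom_inv_id, Category.comp_id, Category.id_comp])
  inv_hom_id := A₂.torsion_hom_ext (by
    rw [Category.assoc, torsionMap_ι, torsionMap_ι_assoc, φ.inv_hom_id, Category.comp_id, Category.id_comp])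

/-- Unfolding: `(φ[N]).hom = φ.hom[N]`. [cite: Tate1967, §2 (2.1)] -/
@[simp] theorem torsionIsoOfIso_hom (N : ℕ) : (torsionIsoOfIso φ N).hom = torsionMap φ.hom N := rfl

/-- Unfolding: `(φ[N]).inv = φ⁻¹[N]`. [cite: Tate1967, §2 (2.1)] -/
@[simp] theorem torsionIsoOfIso_inv (N : ℕ) : (torsionIsoOfIso φ N).inv = torsionMap φ.inv N := rfl

end TorsionIso

/-! ## §2 `φ[N]` intertwines the torsion maps of intertwined endomorphisms -/

namespace RingAction

section Comm

variable {S : Scheme.{u}} {A₁ A₂ : AbelianSchemeOver S} {O : Type v} [CommRing O] (act₁ : RingAction O A₁) (act₂ : RingAction O A₂)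
  (φ : A₁.X ≅ A₂.X) [IsMonHom φ.hom]

/-- **`φ[N]` intertwines `ι₁(r)[N]` and `ι₂(r)[N]`** when `φ` intertwines `ι₁(r)` and `ι₂(r)` (both sides restrict `ι₁(r) ≫ φ = φ ≫ ι₂(r)`
along the monomorphism `𝒜₂[N] ↪ 𝒜₂`; ★ `torsionMap_ι`, ★ `torsion_hom_ext`). [cite: Tate1967, §2 (2.1)] [cite: Kottwitz1992, §5 (p. 390)] -/
theorem torsionMap_comm_of_comm (r : O) (hφ : φ.hom ≫ act₂.i r = act₁.i r ≫ φ.hom) (N : ℕ) :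
    torsionMap φ.hom N ≫ (haveI := act₂.isMonHom_i r; torsionMap (act₂.i r) N) =
      (haveI := act₁.isMonHom_i r; torsionMap (act₁.i r) N) ≫ torsionMap φ.hom N := by
  haveI := act₁.isMonHom_i r
  haveI := act₂.isMonHom_i r
  exact A₂.torsion_hom_ext (by rw [Category.assoc, torsionMap_ι, torsionMap_ι_assoc, hφ, Category.assoc, torsionMap_ι, torsionMap_ι_assoc])

end Comm

/-! ## §3 The fixed parts of the block idempotents have equal ranks -/

section Rank

variable {R : Type u} [CommRing R] {A₁ A₂ : AbelianSchemeOver (Spec (.of R))} [IsCommMonObj A₁.X] [IsCommMonObj A₂.X]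
  {g₁ g₂ : ℕ} (hg₁ : A₁.IsOfRelDim g₁) (hg₂ : A₂.IsOfRelDim g₂) {p : ℕ} (hp : p ≠ 0) {O : Type v} [CommRing O]
  (act₁ : RingAction O A₁) (act₂ : RingAction O A₂) (φ : A₁.X ≅ A₂.X) [IsMonHom φ.hom]
  (hφ : ∀ r, φ.hom ≫ act₂.i r = act₁.i r ≫ φ.hom) (a : ℕ → O) (ha : ∀ n, a (n + 1) - a n ∈ Ideal.span {(p : O) ^ n})
  (ha2 : ∀ n, a n * a n - a n ∈ Ideal.span {(p : O) ^ n})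

include hφ ha2 in
/-- **EQUIVARIANT ISOMORPHISMS PRESERVE BLOCK RANKS.**  For abelian schemes `𝒜₁`, `𝒜₂` over `Spec R` with commutative laws and ring actions
`act₁`, `act₂ : RingAction O 𝒜ᵢ`, an isomorphism `φ : 𝒜₁ ≅ 𝒜₂` of group schemes intertwining the actions, `p ≠ 0` and a compatible idempotent
family `a` (`aₙ₊₁ − aₙ ∈ (pⁿ)`, `aₙ² − aₙ ∈ (pⁿ)` — the `w`-block idempotent read modulo `pⁿ`), the fixed subschemes of the layer idempotents
`β₁(a)_n = ι₁(aₙ)[pⁿ]` and `β₂(a)_n = ι₂(aₙ)[pⁿ]` (★ `isRingActionBT_pDivisibleGroupMap`, ★ `homOfCompatibleFamily`, ★ `fixLayer`) have THE SAME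
RANK at every `s ∈ Spec R`: ★ `finrank_fix_hom_eq_of_iso` along `torsionIsoOfIso φ (pⁿ)` (§2 at `r := aₙ`; `β₂(a)_n` idempotent by ★
`homOfCompatibleFamily_idem`; `𝒜₂[pⁿ]` finite flat by ★ `isFinite_torsion_hom` ∕ `flat_torsion_hom`).
[cite: Tate1967, §2 (2.1)] [cite: GortzWedhorn2020, Definition 4.45 (2), p. 117] -/
theorem finrank_fixLayer_eq_of_iso (n : ℕ) (s : ↥(Spec (.of R))) :
    (((isRingActionBT_pDivisibleGroupMap act₁ hp hg₁).homOfCompatibleFamily a ha).fixLayer n).hom.finrank s =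
      (((isRingActionBT_pDivisibleGroupMap act₂ hp hg₂).homOfCompatibleFamily a ha).fixLayer n).hom.finrank s := by
  letI : GrpObj (A₁.torsion (p ^ n)) := (A₁.pDivisibleGroup hp hg₁).grpObj n
  letI : GrpObj (A₂.torsion (p ^ n)) := (A₂.pDivisibleGroup hp hg₂).grpObj n
  haveI : IsFinite (A₂.torsion (p ^ n)).hom := A₂.isFinite_torsion_hom (pow_ne_zero n hp)
  haveI : Flat (A₂.torsion (p ^ n)).hom := A₂.flat_torsion_hom (pow_ne_zero n hp)
  exact finrank_fix_hom_eq_of_iso _ _ (torsionIsoOfIso φ (p ^ n)) (torsionMap_comm_of_comm act₁ act₂ φ (a n) (hφ (a n)) (p ^ n))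
    ((isRingActionBT_pDivisibleGroupMap act₂ hp hg₂).homOfCompatibleFamily_idem a ha ha2 n) s

include hφ ha2 in
/-- **THE `hrank` BINDER TRANSPORTS ALONG AN EQUIVARIANT ISOMORPHISM**: if the fixed part of `β₁(a)` on `𝒜₁[p^∞]` has rank `p^{n h}` in every
layer at every point (ED. 7 `blockDocking_of_line`'s `hrank` at `(𝒜₁, act₁)`), then so does the fixed part of `β₂(a)` on `𝒜₂[p^∞]` (§3).
[cite: Tate1967, §2 (2.1)] [cite: GortzWedhorn2020, Definition 4.45 (2), p. 117] -/
theorem hrank_of_iso {h : ℕ}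
    (hrank₁ : ∀ (n : ℕ) (s : ↥(Spec (.of R))),
      (((isRingActionBT_pDivisibleGroupMap act₁ hp hg₁).homOfCompatibleFamily a ha).fixLayer n).hom.finrank s = p ^ (n * h)) :
    ∀ (n : ℕ) (s : ↥(Spec (.of R))),
      (((isRingActionBT_pDivisibleGroupMap act₂ hp hg₂).homOfCompatibleFamily a ha).fixLayer n).hom.finrank s = p ^ (n * h) := by
  intro n s
  rw [← finrank_fixLayer_eq_of_iso hg₁ hg₂ hp act₁ act₂ φ hφ a ha ha2 n s]
  exact hrank₁ n s

end Rank

end RingAction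

end AbelianSchemeOver

end Literature.AlgebraicGeometry.AbelianSchemes

end
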